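import Literature.Geometry.Lorentzian.GaussFormulaTangential
import Literature.Geometry.Lorentzian.MeanCurvatureRegularity
import HarnessLib

/-!
# The Gauss equation of an immersed hypersurface, on a coordinate pair

O'Neill 1983, Ch. 4, Thm. 5 (p. 100), the **Gauss equation**: for a semi-Riemannian submanifold
`M ⊂ M̄` with curvature tensors `R`, `R̄` and shape tensor `II`, and `V, W, X, Y` tangent to `M`,
`⟨R_{VW}X, Y⟩ = ⟨R̄_{VW}X, Y⟩ + ⟨II(V,X), II(W,Y)⟩ − ⟨II(V,Y), II(W,X)⟩`. For a hypersurface with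
unit normal `ν` of sign `ε` and scalar second fundamental form `K(v, w) = g(D_v ν, df w)` (the
tree's `secondFundamentalForm`, so that `II(v, w) = −ε K(v, w) ν`), and in the curvature sign
convention of this directory (`R(X,Y) = ∇_X∇_Y − ∇_Y∇_X − ∇_{[X,Y]}`, opposite to O'Neill's), this
reads `⟨R(V,W)X, Y⟩ = ⟨R̄(V,W)X, Y⟩ + (K(V,Y) K(W,X) − K(V,X) K(W,Y))/ε`.

* `gauss_equation_localFrame` — **the Gauss equation on a coordinate pair**: for a smooth
  spacelike immersion `f : (N, f^*g) → (M, g)` of a hypersurface (`dim M = dim N + 1`) with a unit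
  normal field `ν` of sign `ε ≠ 0` (smooth lift to `TM`), a point `y₀` and two coordinate fields
  `∂ᵢ, ∂ⱼ` of a chart at `y₀`:
  `(f^*g)(R(∂ᵢ,∂ⱼ)∂ⱼ, ∂ᵢ) = g(R̄(df ∂ᵢ, df ∂ⱼ) df ∂ⱼ, df ∂ᵢ)`
  `  + (K(∂ᵢ,∂ᵢ)K(∂ⱼ,∂ⱼ) − K(∂ᵢ,∂ⱼ)K(∂ⱼ,∂ᵢ))/ε` at `y₀` (`V = Y = ∂ᵢ`, `W = X = ∂ⱼ`), which is
  all that is needed for sectional and scalar curvature of surfaces.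

The proof follows O'Neill's ("as usual we can suppose `[V, W] = 0`…"), organised through the
two-parameter map `x(t, s) = φ⁻¹(φ y₀ + t eᵢ + s eⱼ)` (the coordinate rectangle, so that
`x_t = ∂ᵢ ∘ x`, `x_s = ∂ⱼ ∘ x`) and its image `F = f ∘ x`, with the field `Z = df(∂ⱼ ∘ x)` along
`F`: by `covariantDerivAlong_covariantDerivAlong_sub_eq_curvature` (O'Neill, Prop. 4.44 (2)) in `M`
and in `N`, `g(R̄(F_t, F_s)Z, df ∂ᵢ) = g(D_tD_sZ − D_sD_tZ, df ∂ᵢ)` and likewise in `N`; the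
first-order pairings `g(D_sZ, df ∂ᵢ)` and `(f^*g)(D_s x_s, ∂ᵢ)` AGREE along the `t`-curve (the Gauss
formula, tangential part, `GaussFormulaTangential.lean`), so their `t`-derivatives agree, and
metric compatibility (`hasDerivAt_val_apply_along`) turns these into the second-order pairings plus
cross terms `g(D_sZ, D_t(df ∂ᵢ))`; the cross terms split into tangential parts (again identified by
the tangential Gauss formula) and normal parts `g(D̄(df ∂ₐ), ν) = −K` (differentiating
`g(df ∂ₐ, ν) = 0`, O'Neill Cor. 4.2 (5) and Lemma 4.4) by the tangent–normal decomposition of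
`T_{f y}M` for a hypersurface (`val_eq_inducedMetric_add_normal`).

Supporting results (all proved): `mdifferentiableAt_lift_covariantDerivAlong_curry_right/left`
(the partial covariant derivatives of a `C²` field along a `C²` two-parameter map have
differentiable lifts), `velocity_symm_comp₀`, `velocity_comp_symm_comp₀`,
`covariantDerivAlong_localFrame_symm_comp₀`, `covariantDerivAlong_normal_symm_comp₀`
(velocities and covariant derivatives along chart-parametrised curves, with base points written as
evaluated so that they compose syntactically),
`val_covariantDerivAlong_mfderiv_localFrame_symm_comp₀` and
`val_covariantDerivAlong_mfderiv_localFrame_normal₀` (tangential and normal components of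
`D̄(df ∂ₐ)` along affine chart paths), `val_eq_inducedMetric_add_normal`.

Everything is proved; there are no definitions and no named facts.

## References

* B. O'Neill, *Semi-Riemannian geometry with applications to relativity*, Academic Press 1983,
  Ch. 4: Lemma 1, Cor. 2, Lemma 3, Lemma 4, Thm. 5 and its Corollary (pp. 97–101), pp. 106–107
  (hypersurfaces, sign `ε`), Prop. 44 (p. 123); Ch. 3, Prop. 3.18.
* J. M. Lee, *Introduction to Riemannian Manifolds*, 2nd ed., Springer 2018, Thm. 8.5 (Gauss
  equation), Thm. 8.13 (hypersurfaces).
-/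

noncomputable section

open Bundle Set Filter Function Manifold
open scoped Manifold ContDiff Topology

namespace Literature.Geometry.Lorentzian

variable {E : Type*} [NormedAddCommGroup E] [NormedSpace ℝ E] {H : Type*} [TopologicalSpace H]
  {I : ModelWithCorners ℝ E H} {M : Type*} [TopologicalSpace M] [ChartedSpace H M]
  [IsManifold I ∞ M]

/-! ### The field `D_s Z` along the `t`-curve has a differentiable lift -/

section Lift

variable [FiniteDimensional ℝ E] (cov : CovariantDerivative I E (TangentSpace I : M → Type _))
  {x : ℝ → ℝ → M} {Z : (t : ℝ) → (s : ℝ) → TangentSpace I (x t s)} {t s : ℝ}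

/-- **`t ↦ (x(t,s), D_s Z(t,s))` is a differentiable curve in `TM`.** For a locally `C¹` covariant
derivative, a two-parameter map `x` which is `C²` at `(t, s)` and a field `Z` along it with `C²`
lift, the lift to `TM` of the partial covariant derivative `t' ↦ D_s Z(t', s)` along the
`t`-parameter curve is differentiable at `t`: in the chart at `x(t, s)` it is the frame combination
with coefficients the coordinates `bʲ(Φ t')` of the chart formula
`Φ = ∂_s Ẑ + ∑ᵢ Zⁱ Ĉᵢ(∂_s x̂)` (`continuousLinearMapAt_covariantDerivAlong_curry_right`), which are
differentiable (`Ẑ`, `x̂` are `C²`, `Ĉᵢ` is `C¹`). This is the regularity implicit in O'Neill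
1983, Ch. 4, p. 123 (`Z_{uv}` exists for smooth data). [cite: ONeill1983, Ch. 4, p. 123] -/
theorem mdifferentiableAt_lift_covariantDerivAlong_curry_right (hcov : cov.IsLocallyContMDiff 1)
    (hx : ContMDiffAt (𝓘(ℝ, ℝ).prod 𝓘(ℝ, ℝ)) I 2 (uncurry x) (t, s))
    (hZ : ContMDiffAt (𝓘(ℝ, ℝ).prod 𝓘(ℝ, ℝ)) I.tangent 2
      (fun q : ℝ × ℝ ↦ (TotalSpace.mk' E (x q.1 q.2) (Z q.1 q.2) : TangentBundle I M)) (t, s)) :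
    MDifferentiableAt 𝓘(ℝ, ℝ) I.tangent (fun t' ↦ (TotalSpace.mk' E (x t' s)
      (covariantDerivAlong cov (x t') (Z t') s) : TangentBundle I M)) t := by
  set x₁ := x t s with hx₁
  set b := Module.finBasis ℝ E
  have hsrc : x t s ∈ (chartAt H x₁).source := mem_chart_source H (x t s)
  obtain ⟨Ĉ, hĈ, hĈs⟩ := exists_contMDiffOn_christoffel cov hcov b x₁
  set zc : ℝ × ℝ → E := fun q ↦ ((trivializationAt E (TangentSpace I : M → Type _) x₁)
    (TotalSpace.mk' E (x q.1 q.2) (Z q.1 q.2) : TangentBundle I M)).2 with hzc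
  set X : ℝ × ℝ → E := fun q ↦ extChartAt I x₁ (x q.1 q.2) with hX
  have hev2 : ∀ᶠ q : ℝ × ℝ in 𝓝 (t, s), ContMDiffAt (𝓘(ℝ, ℝ).prod 𝓘(ℝ, ℝ)) I 2 (uncurry x) q ∧
      ContMDiffAt (𝓘(ℝ, ℝ).prod 𝓘(ℝ, ℝ)) I.tangent 2
        (fun q : ℝ × ℝ ↦ (TotalSpace.mk' E (x q.1 q.2) (Z q.1 q.2) : TangentBundle I M)) q ∧
      x q.1 q.2 ∈ (chartAt H x₁).source := by
    refine ((contMDiffAt_iff_contMDiffAt_nhds (by decide)).1 hx).and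
      ((((contMDiffAt_iff_contMDiffAt_nhds (by decide)).1 hZ)).and ?_)
    exact hx.continuousAt.preimage_mem_nhds ((chartAt H x₁).open_source.mem_nhds hsrc)
  have hl : Tendsto (fun t' : ℝ ↦ ((t', s) : ℝ × ℝ)) (𝓝 t) (𝓝 (t, s)) :=
    (continuous_id.prodMk continuous_const).tendsto t
  set Φ : ℝ → E := fun t' ↦ deriv (fun s' ↦ zc (t', s')) s
    + ∑ i, b.coord i (zc (t', s)) • Ĉ i (x t' s) (deriv (fun s' ↦ X (t', s')) s) with hΦ
  have hΦeq : ∀ᶠ t' in 𝓝 t,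
      (trivializationAt E (TangentSpace I : M → Type _) x₁).continuousLinearMapAt ℝ (x t' s)
        (covariantDerivAlong cov (x t') (Z t') s) = Φ t' := by
    filter_upwards [hl.eventually hev2] with t' ht'
    exact continuousLinearMapAt_covariantDerivAlong_curry_right cov b Ĉ hĈ ht'.2.2 ht'.1 ht'.2.1
  have hsrc_t : ∀ᶠ t' in 𝓝 t, x t' s ∈ (chartAt H x₁).source :=
    (hl.eventually hev2).mono fun _ h ↦ h.2.2
  have hgerm : (fun t' ↦ (TotalSpace.mk' E (x t' s) (∑ j, b.coord j (Φ t') •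
      (trivializationAt E (TangentSpace I : M → Type _) x₁).localFrame b j (x t' s)) :
        TangentBundle I M)) =ᶠ[𝓝 t]
      fun t' ↦ (TotalSpace.mk' E (x t' s) (covariantDerivAlong cov (x t') (Z t') s) :
        TangentBundle I M) := by
    filter_upwards [hΦeq, hsrc_t] with t' ht' hts
    have hte : x t' s ∈ (trivializationAt E (TangentSpace I : M → Type _) x₁).baseSet := by
      simpa using hts
    have hexp := (trivializationAt E (TangentSpace I : M → Type _) x₁).eq_sum_localFrame_coeff_smul
      (I := I) (b := b) (s := fun _ ↦ covariantDerivAlong cov (x t') (Z t') s) hte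
    simp only [(trivializationAt E (TangentSpace I : M → Type _) x₁).localFrame_coeff_eq_coeff
      (b := b) (s := fun _ ↦ covariantDerivAlong cov (x t') (Z t') s) hte] at hexp
    rw [← Trivialization.continuousLinearMapAt_apply_of_mem ℝ _ hte, ht'] at hexp
    simp only [Module.Basis.coord_apply]
    rw [← hexp]
  -- `Φ` is differentiable at `t`
  have hzc2 : ContDiffAt ℝ 2 zc (t, s) := contDiffAt_trivializationAt_snd_uncurry hsrc hZ
  have hX2 : ContDiffAt ℝ 2 X (t, s) := contDiffAt_extChartAt_uncurry' hsrc hx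
  have hzc_ts := (deriv_deriv_comm_of_contDiffAt hzc2).1
  have hX_ts := (deriv_deriv_comm_of_contDiffAt hX2).1
  have hlt : HasDerivAt (fun t' : ℝ ↦ ((t', s) : ℝ × ℝ)) ((1 : ℝ), (0 : ℝ)) t := by
    simpa using (hasDerivAt_id t).prodMk (hasDerivAt_const t s)
  have hzc_t : HasDerivAt (fun t' ↦ zc (t', s)) (fderiv ℝ zc (t, s) (1, 0)) t := by
    have h := (hzc2.differentiableAt (by norm_num)).hasFDerivAt.comp_hasDerivAt t hlt
    exact h
  have hcoef : ∀ i, DifferentiableAt ℝ (fun t' ↦ b.coord i (zc (t', s))) t :=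
    fun i ↦ (((b.coord i).toContinuousLinearMap).hasFDerivAt.comp_hasDerivAt t
      hzc_t).differentiableAt
  have hcurve : MDifferentiableAt 𝓘(ℝ, ℝ) I (fun t' ↦ x t' s) t :=
    mdifferentiableAt_curry_left hx two_ne_zero
  have hC : ∀ i, DifferentiableAt ℝ (fun t' ↦ Ĉ i (x t' s)) t := fun i ↦
    (hasDerivAt_comp_curve_vec (γ := fun t' ↦ x t' s)
      (((hĈs i).contMDiffAt ((chartAt H x₁).open_source.mem_nhds
      hsrc)).mdifferentiableAt one_ne_zero) hcurve).differentiableAt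
  have hΦd : DifferentiableAt ℝ Φ t := by
    refine hzc_ts.differentiableAt.add (DifferentiableAt.fun_sum fun i _ ↦ ?_)
    exact (hcoef i).smul ((hC i).clm_apply hX_ts.differentiableAt)
  have hcj : ∀ j, DifferentiableAt ℝ (fun t' ↦ b.coord j (Φ t')) t :=
    fun j ↦ ((b.coord j).toContinuousLinearMap).differentiableAt.comp t hΦd
  exact (mdifferentiableAt_lift_sum_smul_localFrame b (γ := fun t' ↦ x t' s) (t := t) hsrc hcurve
    hcj).congr_of_eventuallyEq hgerm.symm

/-- **`s ↦ (x(t,s), D_t Z(t,s))` is a differentiable curve in `TM`** (the previous result for the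
map with the parameters exchanged). [cite: ONeill1983, Ch. 4, p. 123] -/
theorem mdifferentiableAt_lift_covariantDerivAlong_curry_left (hcov : cov.IsLocallyContMDiff 1)
    (hx : ContMDiffAt (𝓘(ℝ, ℝ).prod 𝓘(ℝ, ℝ)) I 2 (uncurry x) (t, s))
    (hZ : ContMDiffAt (𝓘(ℝ, ℝ).prod 𝓘(ℝ, ℝ)) I.tangent 2
      (fun q : ℝ × ℝ ↦ (TotalSpace.mk' E (x q.1 q.2) (Z q.1 q.2) : TangentBundle I M)) (t, s)) :
    MDifferentiableAt 𝓘(ℝ, ℝ) I.tangent (fun s' ↦ (TotalSpace.mk' E (x t s')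
      (covariantDerivAlong cov (fun t' ↦ x t' s') (fun t' ↦ Z t' s') t) : TangentBundle I M)) s :=
  mdifferentiableAt_lift_covariantDerivAlong_curry_right cov (x := fun s' t' ↦ x t' s')
    (Z := fun s' t' ↦ Z t' s') hcov (contMDiffAt_uncurry_flip hx)
    (hZ.comp (s, t) (contMDiffAt_snd.prodMk contMDiffAt_fst))

end Lift



/-! ### Velocities and covariant derivatives along chart-parametrised curves, at `t = 0` -/

section ChartCurves

variable {E' : Type*} [NormedAddCommGroup E'] [NormedSpace ℝ E'] {H' : Type*} [TopologicalSpace H']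
  {I' : ModelWithCorners ℝ E' H'} {N : Type*} [TopologicalSpace N] [ChartedSpace H' N]
  [IsManifold I' ∞ N] [I'.Boundaryless] {y₀ : N} {ι : Type*} [Fintype ι] (b' : Module.Basis ι ℝ E')

omit [IsManifold I ∞ M] in
/-- **Velocity of a chart-parametrised curve at `0`.** For a path `ℓ : ℝ → E'` in the target of the
extended chart `φ` at `y₀`, differentiable at `0` with derivative `w`, the velocity at `0` of
`t ↦ φ⁻¹(ℓ t)` is `∑_d w^d ∂_d` at `φ⁻¹(ℓ 0)` (as `velocity_chartLine`, which is the case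
`ℓ t = z + t w`; the base point is written `φ⁻¹(ℓ 0)` so that it matches the evaluated curve).
O'Neill 1983, Ch. 1, Prop. 1.16 and Ch. 4, p. 122. [cite: ONeill1983, Ch. 4, p. 122] -/
theorem velocity_symm_comp₀ {ℓ : ℝ → E'} {w : E'} (hℓ0 : ℓ 0 ∈ (extChartAt I' y₀).target)
    (hℓ : HasDerivAt ℓ w 0) :
    velocity I' (fun t : ℝ ↦ (extChartAt I' y₀).symm (ℓ t)) 0 =
      ∑ d, b'.coord d w • (trivializationAt E' (TangentSpace I') y₀).localFrame b' d
        ((extChartAt I' y₀).symm (ℓ 0)) := by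
  have hsrc : (extChartAt I' y₀).symm (ℓ 0) ∈ (chartAt H' y₀).source := by
    rw [← extChartAt_source I']; exact (extChartAt I' y₀).map_target hℓ0
  have h1s : ContMDiffAt 𝓘(ℝ, E') I' ∞ (extChartAt I' y₀).symm (ℓ 0) :=
    (contMDiffOn_extChartAt_symm y₀).contMDiffAt ((isOpen_extChartAt_target y₀).mem_nhds hℓ0)
  have hγ : MDifferentiableAt 𝓘(ℝ, ℝ) I' (fun t : ℝ ↦ (extChartAt I' y₀).symm (ℓ t)) 0 :=
    (h1s.mdifferentiableAt (by simp)).comp 0 hℓ.differentiableAt.mdifferentiableAt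
  have h1 := hasDerivAt_extChartAt_comp (x₁ := y₀) hγ hsrc
  have hev : (extChartAt I' y₀ ∘ fun t : ℝ ↦ (extChartAt I' y₀).symm (ℓ t)) =ᶠ[𝓝 0] ℓ := by
    have hmem : ∀ᶠ t : ℝ in 𝓝 0, ℓ t ∈ (extChartAt I' y₀).target :=
      hℓ.continuousAt.preimage_mem_nhds ((isOpen_extChartAt_target y₀).mem_nhds hℓ0)
    filter_upwards [hmem] with t ht
    exact (extChartAt I' y₀).right_inv ht
  have h2 : HasDerivAt (extChartAt I' y₀ ∘ fun t : ℝ ↦ (extChartAt I' y₀).symm (ℓ t)) w 0 :=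
    hℓ.congr_of_eventuallyEq hev
  have hA : (trivializationAt E' (TangentSpace I') y₀ ⟨(extChartAt I' y₀).symm (ℓ 0),
      velocity I' (fun t : ℝ ↦ (extChartAt I' y₀).symm (ℓ t)) 0⟩).2 = w := by
    have h1' := h1.deriv
    rw [h2.deriv] at h1'
    exact h1'.symm
  have key := sum_coord_smul_localFrame_eq (I := I') b' hsrc
    (velocity I' (fun t : ℝ ↦ (extChartAt I' y₀).symm (ℓ t)) 0)
  rw [Trivialization.continuousLinearMapAt_apply_of_mem ℝ _ (by simpa using hsrc), hA] at key
  exact key.symm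

omit [IsManifold I ∞ M] in
/-- **Velocity of the image under `f` of a chart-parametrised curve at `0`**: `df(∑_d w^d ∂_d)` at
`φ⁻¹(ℓ 0)` (`velocity_comp`, `velocity_symm_comp₀`). [cite: ONeill1983, Ch. 4, p. 122] -/
theorem velocity_comp_symm_comp₀ {f : N → M} {ℓ : ℝ → E'} {w : E'}
    (hℓ0 : ℓ 0 ∈ (extChartAt I' y₀).target) (hℓ : HasDerivAt ℓ w 0)
    (hf : MDifferentiableAt I' I f ((extChartAt I' y₀).symm (ℓ 0))) :
    velocity I (fun t : ℝ ↦ f ((extChartAt I' y₀).symm (ℓ t))) 0 =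
      mfderiv I' I f ((extChartAt I' y₀).symm (ℓ 0))
        (∑ d, b'.coord d w • (trivializationAt E' (TangentSpace I') y₀).localFrame b' d
          ((extChartAt I' y₀).symm (ℓ 0))) := by
  have h1s : ContMDiffAt 𝓘(ℝ, E') I' ∞ (extChartAt I' y₀).symm (ℓ 0) :=
    (contMDiffOn_extChartAt_symm y₀).contMDiffAt ((isOpen_extChartAt_target y₀).mem_nhds hℓ0)
  have hγ : MDifferentiableAt 𝓘(ℝ, ℝ) I' (fun t : ℝ ↦ (extChartAt I' y₀).symm (ℓ t)) 0 :=
    (h1s.mdifferentiableAt (by simp)).comp 0 hℓ.differentiableAt.mdifferentiableAt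
  have h := velocity_comp (I := I) (I' := I') (γ := fun t : ℝ ↦ (extChartAt I' y₀).symm (ℓ t))
    (t := 0) hf hγ
  rw [velocity_symm_comp₀ b' hℓ0 hℓ] at h
  exact h

variable [FiniteDimensional ℝ E']

omit [IsManifold I ∞ M] in
/-- **The induced covariant derivative of a coordinate field along a chart-parametrised curve, at
`0`**: for a covariant derivative `cov` on `TN`, `D(∂ₐ ∘ φ⁻¹ ∘ ℓ)/dt (0) = ∇_{∑ w^d ∂_d} ∂ₐ` at
`φ⁻¹(ℓ 0)` (`covariantDerivAlong_comp_holds`: the covariant derivative along a curve of a restricted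
vector field is `∇_{γ'}`; O'Neill 1983, Ch. 3, Prop. 3.18 (3)).
[cite: ONeill1983, Ch. 3, Prop. 3.18 (3)] -/
theorem covariantDerivAlong_localFrame_symm_comp₀
    (cov : CovariantDerivative I' E' (TangentSpace I' : N → Type _)) {ℓ : ℝ → E'} {w : E'}
    (hℓ0 : ℓ 0 ∈ (extChartAt I' y₀).target) (hℓ : HasDerivAt ℓ w 0) (a : ι) :
    covariantDerivAlong cov (fun t : ℝ ↦ (extChartAt I' y₀).symm (ℓ t))
        (fun t ↦ (trivializationAt E' (TangentSpace I') y₀).localFrame b' a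
          ((extChartAt I' y₀).symm (ℓ t))) 0 =
      cov ((trivializationAt E' (TangentSpace I') y₀).localFrame b' a)
        ((extChartAt I' y₀).symm (ℓ 0))
        (∑ d, b'.coord d w • (trivializationAt E' (TangentSpace I') y₀).localFrame b' d
          ((extChartAt I' y₀).symm (ℓ 0))) := by
  have hsrc : (extChartAt I' y₀).symm (ℓ 0) ∈ (chartAt H' y₀).source := by
    rw [← extChartAt_source I']; exact (extChartAt I' y₀).map_target hℓ0
  have h1s : ContMDiffAt 𝓘(ℝ, E') I' ∞ (extChartAt I' y₀).symm (ℓ 0) :=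
    (contMDiffOn_extChartAt_symm y₀).contMDiffAt ((isOpen_extChartAt_target y₀).mem_nhds hℓ0)
  have hγ : MDifferentiableAt 𝓘(ℝ, ℝ) I' (fun t : ℝ ↦ (extChartAt I' y₀).symm (ℓ t)) 0 :=
    (h1s.mdifferentiableAt (by simp)).comp 0 hℓ.differentiableAt.mdifferentiableAt
  have hI'1 : IsManifold I' (1 + 1) N := inferInstanceAs (IsManifold I' 2 N)
  have hVB' : ContMDiffVectorBundle 1 E' (TangentSpace I' : N → Type _) I' :=
    TangentBundle.contMDiffVectorBundle
  have hY : MDiffAt (T% ((trivializationAt E' (TangentSpace I') y₀).localFrame b' a))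
      ((fun t : ℝ ↦ (extChartAt I' y₀).symm (ℓ t)) 0) :=
    (contMDiffAt_localFrame_of_mem 1 _ b' a (by simpa using hsrc)).mdifferentiableAt one_ne_zero
  have h := covariantDerivAlong_comp_holds (cov := cov) hγ hY
  rw [velocity_symm_comp₀ b' hℓ0 hℓ] at h
  exact h

end ChartCurves


/-! ### `D(ν ∘ c)/dt` along chart-parametrised curves; congruence -/

section NormalAlong

variable [FiniteDimensional ℝ E] [CompleteSpace E]
  (g : PseudoRiemannianMetric I ∞ E (TangentSpace I : M → Type _)) [g.HasLeviCivita]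
  {E' : Type*} [NormedAddCommGroup E'] [NormedSpace ℝ E'] {H' : Type*} [TopologicalSpace H']
  {I' : ModelWithCorners ℝ E' H'} {N : Type*} [TopologicalSpace N] [ChartedSpace H' N]
  [IsManifold I' ∞ N] [FiniteDimensional ℝ E'] [I'.Boundaryless] {f : N → M} {y₀ : N}
  {ι : Type*} [Fintype ι] (b' : Module.Basis ι ℝ E')

omit [CompleteSpace E] [FiniteDimensional ℝ E'] in
/-- **`D(ν ∘ c)/dt (0) = D_{c'(0)} ν` for a chart-parametrised curve.** For a field `ν` along `f`
with differentiable lift and `c = φ⁻¹ ∘ ℓ` with `ℓ' (0) = w`, the covariant derivative at `0` of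
`ν ∘ c` along `f ∘ c` is the tree's `normalDerivAlong` at `c 0` in the direction
`c'(0) = ∑ w^d ∂_d` (both are given by the same frame formula, `covariantDerivAlong_comp_eq_frame`
and `normalDerivAlong_eq_frame`: the induced covariant derivative depends on the curve only through
its velocity). O'Neill 1983, Ch. 4, Lemma 1 (p. 98). [cite: ONeill1983, Ch. 4, Lemma 1] -/
theorem covariantDerivAlong_normal_symm_comp₀ {ν : NormalField I f} {ℓ : ℝ → E'} {w : E'}
    (hℓ0 : ℓ 0 ∈ (extChartAt I' y₀).target) (hℓ : HasDerivAt ℓ w 0)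
    (hν : MDifferentiableAt I' I.tangent
      (fun x ↦ (TotalSpace.mk' E (f x) (ν x) : TangentBundle I M)) ((extChartAt I' y₀).symm (ℓ 0)))
          :
    covariantDerivAlong g.leviCivita (fun t : ℝ ↦ f ((extChartAt I' y₀).symm (ℓ t)))
        (fun t ↦ ν ((extChartAt I' y₀).symm (ℓ t))) 0 =
      g.normalDerivAlong f ν ((extChartAt I' y₀).symm (ℓ 0))
        (∑ d, b'.coord d w • (trivializationAt E' (TangentSpace I') y₀).localFrame b' d
          ((extChartAt I' y₀).symm (ℓ 0))) := by
  have h1s : ContMDiffAt 𝓘(ℝ, E') I' ∞ (extChartAt I' y₀).symm (ℓ 0) :=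
    (contMDiffOn_extChartAt_symm y₀).contMDiffAt ((isOpen_extChartAt_target y₀).mem_nhds hℓ0)
  have hγ : MDifferentiableAt 𝓘(ℝ, ℝ) I' (fun t : ℝ ↦ (extChartAt I' y₀).symm (ℓ t)) 0 :=
    (h1s.mdifferentiableAt (by simp)).comp 0 hℓ.differentiableAt.mdifferentiableAt
  have hsrc : f ((extChartAt I' y₀).symm (ℓ 0)) ∈
      (chartAt H (f ((extChartAt I' y₀).symm (ℓ 0)))).source := mem_chart_source H _
  have h1 := covariantDerivAlong_comp_eq_frame g.leviCivita (Module.finBasis ℝ E) f ν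
    (c := fun t : ℝ ↦ (extChartAt I' y₀).symm (ℓ t)) hsrc hν hγ
  have h2 := g.normalDerivAlong_eq_frame (Module.finBasis ℝ E) hsrc
    BoundarylessManifold.isInteriorPoint hν
    (∑ d, b'.coord d w • (trivializationAt E' (TangentSpace I') y₀).localFrame b' d
      ((extChartAt I' y₀).symm (ℓ 0)))
  rw [velocity_symm_comp₀ b' hℓ0 hℓ] at h1
  exact h1.trans h2.symm

omit [CompleteSpace E] [g.HasLeviCivita]
  [IsManifold I' ∞ N] [FiniteDimensional ℝ E'] [I'.Boundaryless] [Fintype ι] in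
/-- Congruence: the covariant derivative along `f ∘ φ⁻¹ ∘ X` of `Y ∘ φ⁻¹ ∘ X` depends only on the
chart path `X` (stated across the two fibres, both `E`). [folklore] -/
theorem covariantDerivAlong_symm_congr (cov : CovariantDerivative I E (TangentSpace I : M → Type _))
    (Y : Π z : N, TangentSpace I (f z)) {X₁ X₂ : ℝ → E'} (h : X₁ = X₂) :
    (show E from covariantDerivAlong cov (fun t : ℝ ↦ f ((extChartAt I' y₀).symm (X₁ t)))
        (fun t ↦ Y ((extChartAt I' y₀).symm (X₁ t))) 0) =
      (show E from covariantDerivAlong cov (fun t : ℝ ↦ f ((extChartAt I' y₀).symm (X₂ t)))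
        (fun t ↦ Y ((extChartAt I' y₀).symm (X₂ t))) 0) := by
  subst h; rfl

omit [IsManifold I ∞ M] [FiniteDimensional ℝ E] [CompleteSpace E] [g.HasLeviCivita]
  [I'.Boundaryless] [Fintype ι] in
/-- Congruence on `N`: the covariant derivative along `φ⁻¹ ∘ X` of `Y ∘ φ⁻¹ ∘ X` depends only on
the chart path `X`. [folklore] -/
theorem covariantDerivAlong_symm_congr' (cov : CovariantDerivative I' E' (TangentSpace I' : N →
    Type _))
    (Y : Π z : N, TangentSpace I' z) {X₁ X₂ : ℝ → E'} (h : X₁ = X₂) :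
    (show E' from covariantDerivAlong cov (fun t : ℝ ↦ (extChartAt I' y₀).symm (X₁ t))
        (fun t ↦ Y ((extChartAt I' y₀).symm (X₁ t))) 0) =
      (show E' from covariantDerivAlong cov (fun t : ℝ ↦ (extChartAt I' y₀).symm (X₂ t))
        (fun t ↦ Y ((extChartAt I' y₀).symm (X₂ t))) 0) := by
  subst h; rfl

end NormalAlong

/-! ### Tangent–normal decomposition at a point of an immersed hypersurface -/

section Decomposition

variable [FiniteDimensional ℝ E] {n : ℕ∞ω}
  (g : PseudoRiemannianMetric I n E (TangentSpace I : M → Type _))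
  {E' : Type*} [NormedAddCommGroup E'] [NormedSpace ℝ E'] {H' : Type*} [TopologicalSpace H']
  {I' : ModelWithCorners ℝ E' H'} {N : Type*} [TopologicalSpace N] [ChartedSpace H' N]
  [IsManifold I' ∞ N] [FiniteDimensional ℝ E'] {f : N → M}
  (hpb : PseudoRiemannianMetric.contMDiff_pullbackBilin I M I' N n)
  (hfi : g.IsSpacelikeImmersion I' f)

/-- **Tangent–normal decomposition of the metric at a point of an immersed hypersurface.** Let
`f : (N, f^*g) → (M, g)` be a spacelike immersion of a hypersurface (`dim M = dim N + 1`) and `ν`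
a vector at `f y` normal to `df(T_y N)` with `g(ν, ν) = ε ≠ 0`. If the tangential components
of `A, B ∈ T_{f y} M` are `a, b ∈ T_y N` — `g(A, df u) = (f^*g)(a, u)` and
`g(B, df u) = (f^*g)(b, u)` for all `u` — then `g(A, B) = (f^*g)(a, b) + g(A, ν) g(B, ν) / ε`:
indeed `A = df a + (g(A, ν)/ε) ν`, since the difference is orthogonal to
`df(T_y N) ⊕ ℝν = T_{f y} M` (a dimension count, `df_y` injective and `ν ∉ df(T_y N)`) and `g` is
nondegenerate. O'Neill 1983, Ch. 4, pp. 97–100 (`T_p M̄ = T_p M ⊕ T_p M^⊥`, the projections `tan`, `nor`; hypersurfaces with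
sign `ε`, pp. 106–107). [cite: ONeill1983, Ch. 4, pp. 97–100] -/
theorem val_eq_inducedMetric_add_normal {y : N} {νy A B : TangentSpace I (f y)}
    {a b : TangentSpace I' y} {ε : ℝ}
    (hν0 : ∀ u : TangentSpace I' y, g.val (f y) νy (mfderiv I' I f y u) = 0)
    (hνε : g.val (f y) νy νy = ε) (hε : ε ≠ 0)
    (hdim : Module.finrank ℝ E = Module.finrank ℝ E' + 1)
    (hA : ∀ u : TangentSpace I' y, g.val (f y) A (mfderiv I' I f y u) =
      (g.inducedMetric f hpb hfi).val y a u)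
    (hB : ∀ u : TangentSpace I' y, g.val (f y) B (mfderiv I' I f y u) =
      (g.inducedMetric f hpb hfi).val y b u) :
    g.val (f y) A B = (g.inducedMetric f hpb hfi).val y a b +
      g.val (f y) A νy * g.val (f y) B νy / ε := by
  have hinj := hfi.injective_mfderiv y
  -- `df(T_y N) ⊕ ℝ ν = T_{f y} M`
  haveI : FiniteDimensional ℝ (TangentSpace I (f y)) := inferInstanceAs (FiniteDimensional ℝ E)
  set Φ : (E' × ℝ) →ₗ[ℝ] TangentSpace I (f y) :=
    (mfderiv I' I f y).toLinearMap.comp (LinearMap.fst ℝ E' ℝ) +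
      (LinearMap.snd ℝ E' ℝ).smulRight νy with hΦ
  have hΦapply : ∀ (u : E') (r : ℝ), Φ (u, r) = mfderiv I' I f y u + r • νy :=
    fun u r ↦ rfl
  have hΦinj : Function.Injective Φ := by
    refine (injective_iff_map_eq_zero _).2 fun q hq ↦ ?_
    obtain ⟨u, r⟩ := q
    rw [hΦapply] at hq
    have h1 : r * ε = 0 := by
      have := congrArg (fun w ↦ g.val (f y) νy w) hq
      simpa [map_add, map_smul, hν0 u, hνε] using this
    have hr : r = 0 := (mul_eq_zero.1 h1).resolve_right hε
    rw [hr, zero_smul, add_zero] at hq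
    have hu : u = 0 := (injective_iff_map_eq_zero _).1 hinj u hq
    simp [hu, hr]
  have hrank : Module.finrank ℝ (E' × ℝ) = Module.finrank ℝ (TangentSpace I (f y)) := by
    show Module.finrank ℝ (E' × ℝ) = Module.finrank ℝ E
    rw [Module.finrank_prod, Module.finrank_self, hdim]
  have hΦsurj : Function.Surjective Φ :=
    (LinearMap.injective_iff_surjective_of_finrank_eq_finrank hrank).1 hΦinj
  -- the decomposition of `A`
  have hdec : A = mfderiv I' I f y a + (g.val (f y) A νy / ε) • νy := by
    have horth : ∀ w : TangentSpace I (f y),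
        g.val (f y) (A - mfderiv I' I f y a - (g.val (f y) A νy / ε) • νy) w = 0 := by
      intro w
      obtain ⟨⟨u, r⟩, rfl⟩ := hΦsurj w
      rw [hΦapply, map_add, map_smul]
      have h1 : g.val (f y) (A - mfderiv I' I f y a - (g.val (f y) A νy / ε) • νy)
          (mfderiv I' I f y u) = 0 := by
        simp only [map_sub, map_smul, _root_.sub_apply, _root_.smul_apply, hA u, hν0 u,
          smul_eq_mul, mul_zero, sub_zero]
        exact sub_self _
      have h2 : g.val (f y) (A - mfderiv I' I f y a - (g.val (f y) A νy / ε) • νy) νy = 0 := by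
        simp only [map_sub, map_smul, _root_.sub_apply, _root_.smul_apply, hνε, smul_eq_mul]
        rw [g.symm (f y) (mfderiv I' I f y a) νy, hν0 a]
        field_simp
        ring
      rw [h1, h2, smul_zero, add_zero]
    have h0 := g.nondegenerate (f y) _ horth
    rw [sub_sub, sub_eq_zero] at h0
    exact h0
  -- pair with `B`
  conv_lhs => rw [hdec]
  rw [map_add, map_smul, _root_.add_apply, _root_.smul_apply, g.symm (f y) (mfderiv I' I f y a) B,
    hB a, (g.inducedMetric f hpb hfi).symm y b a, g.symm (f y) νy B, smul_eq_mul]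
  ring

end Decomposition


/-! ### The Gauss equation on a coordinate pair -/

section Gauss

variable [FiniteDimensional ℝ E] [CompleteSpace E]
  (g : PseudoRiemannianMetric I ∞ E (TangentSpace I : M → Type _)) [g.HasLeviCivita]
  {E' : Type*} [NormedAddCommGroup E'] [NormedSpace ℝ E'] {H' : Type*} [TopologicalSpace H']
  {I' : ModelWithCorners ℝ E' H'} {N : Type*} [TopologicalSpace N] [ChartedSpace H' N]
  [IsManifold I' ∞ N] [FiniteDimensional ℝ E'] [CompleteSpace E'] [I'.Boundaryless] {f : N → M}
  (hpb : PseudoRiemannianMetric.contMDiff_pullbackBilin I M I' N ∞)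
  (hfi : g.IsSpacelikeImmersion I' f) {ν : NormalField I f} {ε : ℝ}
  {ι : Type*} [Fintype ι] [DecidableEq ι] (b' : Module.Basis ι ℝ E') {y₀ : N}

/-- **Tangential component of `D̄(df ∂ₐ)` along an affine chart path.** For an affine path
`ℓ t = ℓ 0 + t e_d` in the chart target and `Q = φ⁻¹(ℓ 0)`:
`g(D̄(df ∂ₐ ∘ φ⁻¹ ∘ ℓ)(0), df_Q u) = (f^*g)(D(∂ₐ ∘ φ⁻¹ ∘ ℓ)(0), u)` for all `u ∈ T_Q N` — the
Gauss formula, tangential part (`val_covariantDerivAlong_mfderiv_localFrame_chartLine`, O'Neill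
1983, Ch. 4, Lemma 3), with the induced side computed by `covariantDerivAlong_localFrame_symm_comp₀`
and `u` expanded in the coordinate frame. [cite: ONeill1983, Ch. 4, Lemma 3] -/
theorem val_covariantDerivAlong_mfderiv_localFrame_symm_comp₀ {ℓ : ℝ → E'}
    (hℓ0 : ℓ 0 ∈ (extChartAt I' y₀).target) {d : ι} (hℓaff : ∀ t, ℓ t = ℓ 0 + t • b' d) (a : ι)
    (u : TangentSpace I' ((extChartAt I' y₀).symm (ℓ 0))) :
    haveI := (g.inducedMetric f hpb hfi).hasLeviCivita
    g.val (f ((extChartAt I' y₀).symm (ℓ 0)))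
        (covariantDerivAlong g.leviCivita (fun t : ℝ ↦ f ((extChartAt I' y₀).symm (ℓ t))) (fun t ↦
            mfderiv I' I f ((extChartAt I' y₀).symm (ℓ t)) ((trivializationAt E' (TangentSpace I')
            y₀).localFrame b' a ((extChartAt I' y₀).symm (ℓ t)))) 0)
        (mfderiv I' I f ((extChartAt I' y₀).symm (ℓ 0)) (u)) =
      (g.inducedMetric f hpb hfi).val ((extChartAt I' y₀).symm (ℓ 0))
        (covariantDerivAlong (g.inducedMetric f hpb hfi).leviCivita (fun t : ℝ ↦ (extChartAt I'
            y₀).symm (ℓ t)) (fun t ↦ (trivializationAt E' (TangentSpace I') y₀).localFrame b' a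
            ((extChartAt I' y₀).symm (ℓ t))) 0) u := by
  haveI := (g.inducedMetric f hpb hfi).hasLeviCivita
  have hsrc : (extChartAt I' y₀).symm (ℓ 0) ∈ (chartAt H' y₀).source := by
    rw [← extChartAt_source I']; exact (extChartAt I' y₀).map_target hℓ0
  have hℓfun : ℓ = fun t : ℝ ↦ ℓ 0 + t • b' d := funext hℓaff
  have hℓ : HasDerivAt ℓ (b' d) 0 := by
    rw [hℓfun]
    simpa using ((hasDerivAt_id (0 : ℝ)).smul_const (b' d)).const_add (ℓ 0)
  rw [covariantDerivAlong_localFrame_symm_comp₀ b' (g.inducedMetric f hpb hfi).leviCivita hℓ0 hℓ a,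
      sum_coord_basis_smul]
  -- the ambient side on the coordinate frame
  have hX : (fun t : ℝ ↦ (extChartAt I' y₀) ((extChartAt I' y₀).symm (ℓ 0)) + t • b' d) = ℓ := by
    funext t; rw [(extChartAt I' y₀).right_inv hℓ0]; exact (hℓaff t).symm
  have hcongr := covariantDerivAlong_symm_congr (I := I) (I' := I') (y₀ := y₀) g.leviCivita
    (fun z ↦ mfderiv I' I f (z) ((trivializationAt E' (TangentSpace I') y₀).localFrame b' a (z))) hX
  have hc : ∀ c, g.val (f ((extChartAt I' y₀).symm (ℓ 0)))
      (covariantDerivAlong g.leviCivita (fun t : ℝ ↦ f ((extChartAt I' y₀).symm (ℓ t))) (fun t ↦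
          mfderiv I' I f ((extChartAt I' y₀).symm (ℓ t)) ((trivializationAt E' (TangentSpace I')
          y₀).localFrame b' a ((extChartAt I' y₀).symm (ℓ t)))) 0)
      (mfderiv I' I f ((extChartAt I' y₀).symm (ℓ 0)) ((trivializationAt E' (TangentSpace I')
          y₀).localFrame b' c ((extChartAt I' y₀).symm (ℓ 0)))) =
      (g.inducedMetric f hpb hfi).val ((extChartAt I' y₀).symm (ℓ 0)) ((g.inducedMetric f hpb
          hfi).leviCivita ((trivializationAt E' (TangentSpace I') y₀).localFrame b' a) ((extChartAt
          I' y₀).symm (ℓ 0)) ((trivializationAt E' (TangentSpace I') y₀).localFrame b' d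
          ((extChartAt I' y₀).symm (ℓ 0)))) ((trivializationAt E' (TangentSpace I') y₀).localFrame
          b' c ((extChartAt I' y₀).symm (ℓ 0))) :=
    fun c ↦ (congrArg (fun v : E ↦ (show E →L[ℝ] E →L[ℝ] ℝ from g.val (f ((extChartAt I' y₀).symm
        (ℓ 0)))) v
      (show E from mfderiv I' I f ((extChartAt I' y₀).symm (ℓ 0)) ((trivializationAt E'
          (TangentSpace I') y₀).localFrame b' c ((extChartAt I' y₀).symm (ℓ 0)))))
          hcongr).symm.trans
      (val_covariantDerivAlong_mfderiv_localFrame_chartLine g b' hpb hfi hsrc d a c)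
  rw [← sum_coord_smul_localFrame_eq (I := I') b' hsrc u]
  simp only [map_sum, map_smul, smul_eq_mul, hc]

omit [CompleteSpace E'] in
/-- **Normal component of `D̄(df ∂ₐ)` along an affine chart path: `−K(∂_d, ∂ₐ)`.** With `ν` a unit
normal field along `f` (smooth lift) and `ℓ t = ℓ 0 + t e_d`, `Q = φ⁻¹(ℓ 0)`:
`g(D̄(df ∂ₐ ∘ φ⁻¹ ∘ ℓ)(0), ν_Q) = −K_Q(∂_d, ∂ₐ)` — differentiate `g(df ∂ₐ, ν) = 0` along the curve
(`val_covariantDerivAlong_add_eq_zero_of_isNormalTo`, O'Neill 1983, Ch. 4, Cor. 4.2 (5)) and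
identify `D̄(ν ∘ c)(0)` with `D_{∂_d} ν` (`covariantDerivAlong_normal_symm_comp₀`) and
`g(D_{∂_d} ν, df ∂ₐ)` with `K(∂_d, ∂ₐ)` (`secondFundamentalForm_apply_holds`).
[cite: ONeill1983, Ch. 4, Lemma 4 and Cor. 4.2 (5)] -/
theorem val_covariantDerivAlong_mfderiv_localFrame_normal₀ (hf2 : ContMDiff I' I 2 f)
    (hν : ContMDiff I' I.tangent ∞ (fun x ↦ (TotalSpace.mk' E (f x) (ν x) : TangentBundle I M)))
    (hn : g.IsNormalTo I' f ν) {ℓ : ℝ → E'} (hℓ0 : ℓ 0 ∈ (extChartAt I' y₀).target) {d : ι}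
    (hℓaff : ∀ t, ℓ t = ℓ 0 + t • b' d) (a : ι) :
    g.val (f ((extChartAt I' y₀).symm (ℓ 0)))
        (covariantDerivAlong g.leviCivita (fun t : ℝ ↦ f ((extChartAt I' y₀).symm (ℓ t))) (fun t ↦
            mfderiv I' I f ((extChartAt I' y₀).symm (ℓ t)) ((trivializationAt E' (TangentSpace I')
            y₀).localFrame b' a ((extChartAt I' y₀).symm (ℓ t)))) 0)
        (ν ((extChartAt I' y₀).symm (ℓ 0))) =
      - g.secondFundamentalForm I' f ν ((extChartAt I' y₀).symm (ℓ 0)) ((trivializationAt E'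
          (TangentSpace I') y₀).localFrame b' d ((extChartAt I' y₀).symm (ℓ 0))) ((trivializationAt
          E' (TangentSpace I') y₀).localFrame b' a ((extChartAt I' y₀).symm (ℓ 0))) := by
  have hsrc : (extChartAt I' y₀).symm (ℓ 0) ∈ (chartAt H' y₀).source := by
    rw [← extChartAt_source I']; exact (extChartAt I' y₀).map_target hℓ0
  have hℓfun : ℓ = fun t : ℝ ↦ ℓ 0 + t • b' d := funext hℓaff
  have hℓ : HasDerivAt ℓ (b' d) 0 := by
    rw [hℓfun]
    simpa using ((hasDerivAt_id (0 : ℝ)).smul_const (b' d)).const_add (ℓ 0)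
  have h1s : ContMDiffAt 𝓘(ℝ, E') I' ∞ (extChartAt I' y₀).symm (ℓ 0) :=
    (contMDiffOn_extChartAt_symm y₀).contMDiffAt ((isOpen_extChartAt_target y₀).mem_nhds hℓ0)
  have hγ : MDifferentiableAt 𝓘(ℝ, ℝ) I' (fun t : ℝ ↦ (extChartAt I' y₀).symm (ℓ t)) 0 :=
    (h1s.mdifferentiableAt (by simp)).comp 0 hℓ.differentiableAt.mdifferentiableAt
  have hνd : MDifferentiableAt I' I.tangent
      (fun x ↦ (TotalSpace.mk' E (f x) (ν x) : TangentBundle I M)) ((extChartAt I' y₀).symm (ℓ 0))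
          :=
    hν.mdifferentiableAt (by simp)
  have hI'1 : IsManifold I' (1 + 1) N := inferInstanceAs (IsManifold I' 2 N)
  have hVB1 : ContMDiffVectorBundle 1 E' (TangentSpace I' : N → Type _) I' :=
    TangentBundle.contMDiffVectorBundle
  have hSa : MDiffAt (T% ((trivializationAt E' (TangentSpace I') y₀).localFrame b' a)) ((extChartAt
      I' y₀).symm (ℓ 0)) :=
    (contMDiffAt_localFrame_of_mem 1 _ b' a (by simpa using hsrc)).mdifferentiableAt one_ne_zero
  have h := g.val_covariantDerivAlong_add_eq_zero_of_isNormalTo hn (c := fun t : ℝ ↦ (extChartAt I'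
      y₀).symm (ℓ t))
    ((trivializationAt E' (TangentSpace I') y₀).localFrame b' a) (mdifferentiableAt_lift_comp_curve
        (I := I) hγ hνd)
    (mdifferentiableAt_lift_comp_curve (I := I) hγ (mdifferentiableAt_lift_mfderiv hf2 hSa))
  have h' : g.val (f ((extChartAt I' y₀).symm (ℓ 0)))
      (covariantDerivAlong g.leviCivita (fun t : ℝ ↦ f ((extChartAt I' y₀).symm (ℓ t))) (fun t ↦ ν
          ((extChartAt I' y₀).symm (ℓ t))) 0)
      (mfderiv I' I f ((extChartAt I' y₀).symm (ℓ 0)) ((trivializationAt E' (TangentSpace I')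
          y₀).localFrame b' a ((extChartAt I' y₀).symm (ℓ 0)))) +
      g.val (f ((extChartAt I' y₀).symm (ℓ 0))) (ν ((extChartAt I' y₀).symm (ℓ 0)))
        (covariantDerivAlong g.leviCivita (fun t : ℝ ↦ f ((extChartAt I' y₀).symm (ℓ t))) (fun t ↦
            mfderiv I' I f ((extChartAt I' y₀).symm (ℓ t)) ((trivializationAt E' (TangentSpace I')
            y₀).localFrame b' a ((extChartAt I' y₀).symm (ℓ t)))) 0) = 0 := h
  rw [covariantDerivAlong_normal_symm_comp₀ g b' hℓ0 hℓ hνd, sum_coord_basis_smul,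
    ← PseudoRiemannianMetric.secondFundamentalForm_apply_holds
      BoundarylessManifold.isInteriorPoint hνd] at h'
  rw [g.symm]
  linarith

/-- **The Gauss equation on a coordinate pair** (O'Neill 1983, Ch. 4, Thm. 5, p. 100:
`⟨R_{VW}X, Y⟩ = ⟨R̄_{VW}X, Y⟩ + ⟨II(V,X), II(W,Y)⟩ − ⟨II(V,Y), II(W,X)⟩`; Lee, *Riemannian
Manifolds*, Thm. 8.5). For a smooth spacelike immersion `f : (N, f^*g) → (M, g)` of a hypersurface
(`dim M = dim N + 1`), a unit normal field `ν` of sign `ε ≠ 0` along `f` with smooth lift to `TM`,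
a point `y₀` and indices `i, j` of the coordinate frame `∂ₐ` of the chart at `y₀`:
`(f^*g)(R(∂ᵢ,∂ⱼ)∂ⱼ, ∂ᵢ)(y₀) = g(R̄(df ∂ᵢ, df ∂ⱼ)df ∂ⱼ, df ∂ᵢ)(f y₀)`
`  + (K(∂ᵢ,∂ᵢ) K(∂ⱼ,∂ⱼ) − K(∂ᵢ,∂ⱼ) K(∂ⱼ,∂ᵢ))(y₀) / ε`,
with `R`, `R̄` the curvature tensors of `f^*g` and `g` (`riemann`, convention
`R(X,Y) = ∇_X∇_Y − ∇_Y∇_X − ∇_{[X,Y]}`) and `K = secondFundamentalForm` (`K(v,w) = g(D_v ν, df w)`,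
so `⟨II(v,w), II(v',w')⟩ = K(v,w)K(v',w')/ε`; the two sign differences from O'Neill cancel). Proof:
see the module docstring — second covariant derivatives along the coordinate rectangle through `y₀`
(`covariantDerivAlong_covariantDerivAlong_sub_eq_curvature` in `M` and `N`), the tangential Gauss
formula along the coordinate lines (`val_covariantDerivAlong_mfderiv_localFrame_symm_comp₀`), metric
compatibility (`hasDerivAt_val_apply_along`), and the tangent–normal decomposition of the cross
terms (`val_eq_inducedMetric_add_normal`, `val_covariantDerivAlong_mfderiv_localFrame_normal₀`).
[cite: ONeill1983, Ch. 4, Thm. 5] -/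
theorem gauss_equation_localFrame
    (hν : ContMDiff I' I.tangent ∞ (fun x ↦ (TotalSpace.mk' E (f x) (ν x) : TangentBundle I M)))
    (hun : g.IsUnitNormal I' f ν ε) (hε : ε ≠ 0)
    (hdim : Module.finrank ℝ E = Module.finrank ℝ E' + 1) (i j : ι) :
    haveI := (g.inducedMetric f hpb hfi).hasLeviCivita
    (g.inducedMetric f hpb hfi).val y₀ ((g.inducedMetric f hpb hfi).riemann y₀ ((trivializationAt
        E' (TangentSpace I') y₀).localFrame b' i (y₀)) ((trivializationAt E' (TangentSpace I')
        y₀).localFrame b' j (y₀)) ((trivializationAt E' (TangentSpace I') y₀).localFrame b' j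
        (y₀))) ((trivializationAt E' (TangentSpace I') y₀).localFrame b' i (y₀)) =
      g.val (f y₀) (g.riemann (f y₀) (mfderiv I' I f (y₀) ((trivializationAt E' (TangentSpace I')
          y₀).localFrame b' i (y₀))) (mfderiv I' I f (y₀) ((trivializationAt E' (TangentSpace I')
          y₀).localFrame b' j (y₀)))
        (mfderiv I' I f (y₀) ((trivializationAt E' (TangentSpace I') y₀).localFrame b' j (y₀))))
            (mfderiv I' I f (y₀) ((trivializationAt E' (TangentSpace I') y₀).localFrame b' i (y₀)))
      + ((g.secondFundamentalForm I' f ν y₀ ((trivializationAt E' (TangentSpace I') y₀).localFrame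
          b' i (y₀)) ((trivializationAt E' (TangentSpace I') y₀).localFrame b' i (y₀))) *
          (g.secondFundamentalForm I' f ν y₀ ((trivializationAt E' (TangentSpace I') y₀).localFrame
              b' j (y₀)) ((trivializationAt E' (TangentSpace I') y₀).localFrame b' j (y₀))) -
        (g.secondFundamentalForm I' f ν y₀ ((trivializationAt E' (TangentSpace I') y₀).localFrame
            b' i (y₀)) ((trivializationAt E' (TangentSpace I') y₀).localFrame b' j (y₀))) *
          (g.secondFundamentalForm I' f ν y₀ ((trivializationAt E' (TangentSpace I') y₀).localFrame
              b' j (y₀)) ((trivializationAt E' (TangentSpace I') y₀).localFrame b' i (y₀)))) / ε :=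
              by
  haveI := (g.inducedMetric f hpb hfi).hasLeviCivita
  -- regularity and bookkeeping
  have hf : ContMDiff I' I ∞ f := PseudoRiemannianMetric.IsSpacelikeImmersion.contMDiff_self hfi
  have hf2 : ContMDiff I' I 2 f := hf.of_le (by exact WithTop.coe_le_coe.2 le_top)
  have hfd : ∀ z, MDifferentiableAt I' I f z := hf2.mdifferentiable two_ne_zero
  have hcovM : g.leviCivita.IsLocallyContMDiff 1 :=
    g.isLocallyContMDiff_leviCivita_holds 1 (by exact_mod_cast le_top)
  have hcovN : (g.inducedMetric f hpb hfi).leviCivita.IsLocallyContMDiff 1 :=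
    (g.inducedMetric f hpb hfi).isLocallyContMDiff_leviCivita_holds 1 (by exact_mod_cast le_top)
  have hcompatM := (PseudoRiemannianMetric.isLeviCivita_leviCivita_holds (g := g)).2
  have hcompatN := (PseudoRiemannianMetric.isLeviCivita_leviCivita_holds (g := (g.inducedMetric f
      hpb hfi))).2
  have hy₀ : y₀ ∈ (chartAt H' y₀).source := mem_chart_source H' y₀
  have hz : (extChartAt I' y₀) y₀ ∈ (extChartAt I' y₀).target := mem_extChartAt_target y₀
  have hz00 : (extChartAt I' y₀) y₀ + (0 : ℝ) • b' i + (0 : ℝ) • b' j ∈ (extChartAt I' y₀).target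
      := by
    simp only [zero_smul, add_zero]; exact hz
  have hq : (extChartAt I' y₀).symm ((extChartAt I' y₀) y₀ + (0 : ℝ) • b' i + (0 : ℝ) • b' j) = y₀
      := by
    rw [zero_smul, zero_smul, add_zero, add_zero]; exact extChartAt_to_inv y₀
  have hq₁ : (extChartAt I' y₀).symm ((extChartAt I' y₀) y₀ + (0 : ℝ) • b' i + (0 : ℝ) • b' j) ∈
      (chartAt H' y₀).source := by rw [hq]; exact hy₀
  have hq₁e : (extChartAt I' y₀).symm ((extChartAt I' y₀) y₀ + (0 : ℝ) • b' i + (0 : ℝ) • b' j) ∈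
      (trivializationAt E' (TangentSpace I') y₀).baseSet := by
    rw [TangentBundle.trivializationAt_baseSet]; exact hq₁
  have hI'1 : IsManifold I' (1 + 1) N := inferInstanceAs (IsManifold I' 2 N)
  have hI'2 : IsManifold I' (2 + 1) N := inferInstanceAs (IsManifold I' 3 N)
  have hVB1 : ContMDiffVectorBundle 1 E' (TangentSpace I' : N → Type _) I' :=
    TangentBundle.contMDiffVectorBundle
  have hVB2 : ContMDiffVectorBundle 2 E' (TangentSpace I' : N → Type _) I' :=
    TangentBundle.contMDiffVectorBundle
  -- the coordinate rectangle and the two-parameter data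
  have hx2 : ContMDiffAt (𝓘(ℝ, ℝ).prod 𝓘(ℝ, ℝ)) I' 2
      (uncurry fun t s : ℝ ↦ (extChartAt I' y₀).symm ((extChartAt I' y₀) y₀ + t • b' i + s • b' j))
          (0, 0) :=
    (contMDiffAt_chartRect hz (b' i) (b' j)).of_le (by exact WithTop.coe_le_coe.2 le_top)
  have hF2 : ContMDiffAt (𝓘(ℝ, ℝ).prod 𝓘(ℝ, ℝ)) I 2
      (uncurry fun t s : ℝ ↦ f ((extChartAt I' y₀).symm ((extChartAt I' y₀) y₀ + t • b' i + s • b'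
          j))) (0, 0) := hf2.contMDiffAt.comp (0, 0) hx2
  have hSj2 : CMDiffAt 2 (T% ((trivializationAt E' (TangentSpace I') y₀).localFrame b' j))
      ((extChartAt I' y₀).symm ((extChartAt I' y₀) y₀ + (0 : ℝ) • b' i + (0 : ℝ) • b' j)) :=
    contMDiffAt_localFrame_of_mem 2 _ b' j hq₁e
  have hZN2 : ContMDiffAt (𝓘(ℝ, ℝ).prod 𝓘(ℝ, ℝ)) I'.tangent 2
      (fun q : ℝ × ℝ ↦ (TotalSpace.mk' E' ((extChartAt I' y₀).symm ((extChartAt I' y₀) y₀ + q.1 •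
          b' i + q.2 • b' j))
        ((trivializationAt E' (TangentSpace I') y₀).localFrame b' j ((extChartAt I' y₀).symm
            ((extChartAt I' y₀) y₀ + q.1 • b' i + q.2 • b' j))) : TangentBundle I' N)) (0, 0) :=
    hSj2.comp (0, 0) hx2
  have hZM2 : ContMDiffAt (𝓘(ℝ, ℝ).prod 𝓘(ℝ, ℝ)) I.tangent 2
      (fun q : ℝ × ℝ ↦ (TotalSpace.mk' E (f ((extChartAt I' y₀).symm ((extChartAt I' y₀) y₀ + q.1 •
          b' i + q.2 • b' j)))
        (mfderiv I' I f ((extChartAt I' y₀).symm ((extChartAt I' y₀) y₀ + q.1 • b' i + q.2 • b' j))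
            ((trivializationAt E' (TangentSpace I') y₀).localFrame b' j ((extChartAt I' y₀).symm
            ((extChartAt I' y₀) y₀ + q.1 • b' i + q.2 • b' j)))) : TangentBundle I M)) (0, 0) :=
    ((hf.contMDiff_tangentMap le_rfl).contMDiffAt.of_le
      (by exact WithTop.coe_le_coe.2 le_top)).comp (0, 0) hZN2
  -- (c) in `M` and in `N`
  have hM0 := covariantDerivAlong_covariantDerivAlong_sub_eq_curvature g.leviCivita hcovM
    (x := fun t s : ℝ ↦ f ((extChartAt I' y₀).symm ((extChartAt I' y₀) y₀ + t • b' i + s • b' j)))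
    (Z := fun t s : ℝ ↦ mfderiv I' I f ((extChartAt I' y₀).symm ((extChartAt I' y₀) y₀ + t • b' i +
        s • b' j)) ((trivializationAt E' (TangentSpace I') y₀).localFrame b' j ((extChartAt I'
        y₀).symm ((extChartAt I' y₀) y₀ + t • b' i + s • b' j)))) (t := 0) (s := 0) hF2 hZM2
  have hN0 := covariantDerivAlong_covariantDerivAlong_sub_eq_curvature (g.inducedMetric f hpb
      hfi).leviCivita hcovN
    (x := fun t s : ℝ ↦ (extChartAt I' y₀).symm ((extChartAt I' y₀) y₀ + t • b' i + s • b' j))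
    (Z := fun t s : ℝ ↦ (trivializationAt E' (TangentSpace I') y₀).localFrame b' j ((extChartAt I'
        y₀).symm ((extChartAt I' y₀) y₀ + t • b' i + s • b' j))) (t := 0) (s := 0) hx2 hZN2
  -- the partial velocities at `(0, 0)`
  have hℓi : HasDerivAt (fun t : ℝ ↦ (extChartAt I' y₀) y₀ + t • b' i + (0 : ℝ) • b' j) (b' i) 0 :=
      by
    simpa using (((hasDerivAt_id (0 : ℝ)).smul_const (b' i)).const_add ((extChartAt I' y₀)
        y₀)).add_const
      ((0 : ℝ) • b' j)
  have hℓj : HasDerivAt (fun s : ℝ ↦ (extChartAt I' y₀) y₀ + (0 : ℝ) • b' i + s • b' j) (b' j) 0 :=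
      by
    simpa using ((hasDerivAt_id (0 : ℝ)).smul_const (b' j)).const_add ((extChartAt I' y₀) y₀ + (0 :
        ℝ) • b' i)
  rw [velocity_comp_symm_comp₀ b' (ℓ := fun t : ℝ ↦ (extChartAt I' y₀) y₀ + t • b' i + (0 : ℝ) • b'
      j) hz00 hℓi (hfd _),
    velocity_comp_symm_comp₀ b' (ℓ := fun s : ℝ ↦ (extChartAt I' y₀) y₀ + (0 : ℝ) • b' i + s • b'
        j) hz00 hℓj (hfd _),
    sum_coord_basis_smul, sum_coord_basis_smul] at hM0
  rw [velocity_symm_comp₀ b' (ℓ := fun t : ℝ ↦ (extChartAt I' y₀) y₀ + t • b' i + (0 : ℝ) • b' j)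
      hz00 hℓi,
    velocity_symm_comp₀ b' (ℓ := fun s : ℝ ↦ (extChartAt I' y₀) y₀ + (0 : ℝ) • b' i + s • b' j)
        hz00 hℓj,
    sum_coord_basis_smul, sum_coord_basis_smul] at hN0
  have hM := congrArg (fun v ↦ g.val (f ((extChartAt I' y₀).symm ((extChartAt I' y₀) y₀ + (0 : ℝ) •
      b' i + (0 : ℝ) • b' j))) v (mfderiv I' I f ((extChartAt I' y₀).symm ((extChartAt I' y₀) y₀ +
      (0 : ℝ) • b' i + (0 : ℝ) • b' j)) ((trivializationAt E' (TangentSpace I') y₀).localFrame b' i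
      ((extChartAt I' y₀).symm ((extChartAt I' y₀) y₀ + (0 : ℝ) • b' i + (0 : ℝ) • b' j))))) hM0
  have hN := congrArg (fun v ↦ (g.inducedMetric f hpb hfi).val ((extChartAt I' y₀).symm
      ((extChartAt I' y₀) y₀ + (0 : ℝ) • b' i + (0 : ℝ) • b' j)) v ((trivializationAt E'
      (TangentSpace I') y₀).localFrame b' i ((extChartAt I' y₀).symm ((extChartAt I' y₀) y₀ + (0 :
      ℝ) • b' i + (0 : ℝ) • b' j)))) hN0
  simp only [map_sub, _root_.sub_apply] at hM hN

  -- lifts along the parameter curves are differentiable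
  have hVlift := mdifferentiableAt_lift_covariantDerivAlong_curry_right g.leviCivita hcovM
    (x := fun t s : ℝ ↦ f ((extChartAt I' y₀).symm ((extChartAt I' y₀) y₀ + t • b' i + s • b' j)))
        (Z := fun t s : ℝ ↦ mfderiv I' I f ((extChartAt I' y₀).symm ((extChartAt I' y₀) y₀ + t • b'
        i + s • b' j)) ((trivializationAt E' (TangentSpace I') y₀).localFrame b' j ((extChartAt I'
        y₀).symm ((extChartAt I' y₀) y₀ + t • b' i + s • b' j)))) (t := 0) (s := 0) hF2 hZM2
  have hVBlift := mdifferentiableAt_lift_covariantDerivAlong_curry_left g.leviCivita hcovM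
    (x := fun t s : ℝ ↦ f ((extChartAt I' y₀).symm ((extChartAt I' y₀) y₀ + t • b' i + s • b' j)))
        (Z := fun t s : ℝ ↦ mfderiv I' I f ((extChartAt I' y₀).symm ((extChartAt I' y₀) y₀ + t • b'
        i + s • b' j)) ((trivializationAt E' (TangentSpace I') y₀).localFrame b' j ((extChartAt I'
        y₀).symm ((extChartAt I' y₀) y₀ + t • b' i + s • b' j)))) (t := 0) (s := 0) hF2 hZM2
  have hVNlift := mdifferentiableAt_lift_covariantDerivAlong_curry_right (g.inducedMetric f hpb
      hfi).leviCivita hcovN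
    (x := fun t s : ℝ ↦ (extChartAt I' y₀).symm ((extChartAt I' y₀) y₀ + t • b' i + s • b' j)) (Z
        := fun t s : ℝ ↦ (trivializationAt E' (TangentSpace I') y₀).localFrame b' j ((extChartAt I'
        y₀).symm ((extChartAt I' y₀) y₀ + t • b' i + s • b' j))) (t := 0) (s := 0)
    hx2 hZN2
  have hVBNlift := mdifferentiableAt_lift_covariantDerivAlong_curry_left (g.inducedMetric f hpb
      hfi).leviCivita hcovN
    (x := fun t s : ℝ ↦ (extChartAt I' y₀).symm ((extChartAt I' y₀) y₀ + t • b' i + s • b' j)) (Z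
        := fun t s : ℝ ↦ (trivializationAt E' (TangentSpace I') y₀).localFrame b' j ((extChartAt I'
        y₀).symm ((extChartAt I' y₀) y₀ + t • b' i + s • b' j))) (t := 0) (s := 0)
    hx2 hZN2
  have hci : MDifferentiableAt 𝓘(ℝ, ℝ) I' (fun t : ℝ ↦ (extChartAt I' y₀).symm ((extChartAt I' y₀)
      y₀ + t • b' i + (0 : ℝ) • b' j)) 0 :=
    mdifferentiableAt_curry_left hx2 two_ne_zero
  have hcj : MDifferentiableAt 𝓘(ℝ, ℝ) I' (fun s : ℝ ↦ (extChartAt I' y₀).symm ((extChartAt I' y₀)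
      y₀ + (0 : ℝ) • b' i + s • b' j)) 0 :=
    mdifferentiableAt_curry_right hx2 two_ne_zero
  have hSi1 : ∀ t s : ℝ, ∀ a, MDiffAt (T% ((trivializationAt E' (TangentSpace I') y₀).localFrame b'
      a)) ((fun t s : ℝ ↦ (extChartAt I' y₀).symm ((extChartAt I' y₀) y₀ + t • b' i + s • b' j)) t
      s) →
      MDifferentiableAt I' I.tangent (fun z ↦ (TotalSpace.mk' E (f z)
        (mfderiv I' I f (z) ((trivializationAt E' (TangentSpace I') y₀).localFrame b' a (z))) :
            TangentBundle I M)) ((fun t s : ℝ ↦ (extChartAt I' y₀).symm ((extChartAt I' y₀) y₀ + t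
            • b' i + s • b' j)) t s) :=
    fun t s a h ↦ mdifferentiableAt_lift_mfderiv hf2 h
  have hSq : ∀ a, MDiffAt (T% ((trivializationAt E' (TangentSpace I') y₀).localFrame b' a))
      ((extChartAt I' y₀).symm ((extChartAt I' y₀) y₀ + (0 : ℝ) • b' i + (0 : ℝ) • b' j)) := fun a ↦
    (contMDiffAt_localFrame_of_mem 1 _ b' a hq₁e).mdifferentiableAt one_ne_zero
  have hWlift : MDifferentiableAt 𝓘(ℝ, ℝ) I.tangent (fun t : ℝ ↦ (TotalSpace.mk' E
      (f ((extChartAt I' y₀).symm ((extChartAt I' y₀) y₀ + t • b' i + (0 : ℝ) • b' j))) (mfderiv I'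
          I f ((extChartAt I' y₀).symm ((extChartAt I' y₀) y₀ + t • b' i + (0 : ℝ) • b' j))
          ((trivializationAt E' (TangentSpace I') y₀).localFrame b' i ((extChartAt I' y₀).symm
          ((extChartAt I' y₀) y₀ + t • b' i + (0 : ℝ) • b' j)))) : TangentBundle I M)) 0 :=
    mdifferentiableAt_lift_comp_curve (I := I) (f := f) (c := fun t : ℝ ↦ (extChartAt I' y₀).symm
        ((extChartAt I' y₀) y₀ + t • b' i + (0 : ℝ) • b' j))
      (Y := fun z ↦ mfderiv I' I f (z) ((trivializationAt E' (TangentSpace I') y₀).localFrame b' i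
          (z))) hci (hSi1 0 0 i (hSq i))
  have hWBlift : MDifferentiableAt 𝓘(ℝ, ℝ) I.tangent (fun s : ℝ ↦ (TotalSpace.mk' E
      (f ((extChartAt I' y₀).symm ((extChartAt I' y₀) y₀ + (0 : ℝ) • b' i + s • b' j))) (mfderiv I'
          I f ((extChartAt I' y₀).symm ((extChartAt I' y₀) y₀ + (0 : ℝ) • b' i + s • b' j))
          ((trivializationAt E' (TangentSpace I') y₀).localFrame b' i ((extChartAt I' y₀).symm
          ((extChartAt I' y₀) y₀ + (0 : ℝ) • b' i + s • b' j)))) : TangentBundle I M)) 0 :=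
    mdifferentiableAt_lift_comp_curve (I := I) (f := f) (c := fun s : ℝ ↦ (extChartAt I' y₀).symm
        ((extChartAt I' y₀) y₀ + (0 : ℝ) • b' i + s • b' j))
      (Y := fun z ↦ mfderiv I' I f (z) ((trivializationAt E' (TangentSpace I') y₀).localFrame b' i
          (z))) hcj (hSi1 0 0 i (hSq i))
  have hWNlift : MDiffAt (T% ((trivializationAt E' (TangentSpace I') y₀).localFrame b' i)) ((fun t
      : ℝ ↦ (extChartAt I' y₀).symm ((extChartAt I' y₀) y₀ + t • b' i + (0 : ℝ) • b' j)) 0) := hSq i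
  have hWBNlift : MDiffAt (T% ((trivializationAt E' (TangentSpace I') y₀).localFrame b' i)) ((fun s
      : ℝ ↦ (extChartAt I' y₀).symm ((extChartAt I' y₀) y₀ + (0 : ℝ) • b' i + s • b' j)) 0) := hSq i
  -- compatibility along the four parameter curves
  have hA := (g.hasDerivAt_val_apply_along hcompatM (γ := fun t : ℝ ↦ f ((extChartAt I' y₀).symm
      ((extChartAt I' y₀) y₀ + t • b' i + (0 : ℝ) • b' j)))
    (V := fun t : ℝ ↦ covariantDerivAlong g.leviCivita (fun s : ℝ ↦ f ((extChartAt I' y₀).symm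
        ((extChartAt I' y₀) y₀ + t • b' i + s • b' j))) (fun s ↦ mfderiv I' I f ((extChartAt I'
        y₀).symm ((extChartAt I' y₀) y₀ + t • b' i + s • b' j)) ((trivializationAt E' (TangentSpace
        I') y₀).localFrame b' j ((extChartAt I' y₀).symm ((extChartAt I' y₀) y₀ + t • b' i + s • b'
        j)))) 0) (W := fun t : ℝ ↦ mfderiv I' I f ((extChartAt I' y₀).symm ((extChartAt I' y₀) y₀ +
        t • b' i + (0 : ℝ) • b' j)) ((trivializationAt E' (TangentSpace I') y₀).localFrame b' i
        ((extChartAt I' y₀).symm ((extChartAt I' y₀) y₀ + t • b' i + (0 : ℝ) • b' j)))) (t₀ := 0)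
        hVlift hWlift).deriv
  have hB := (g.hasDerivAt_val_apply_along hcompatM (γ := fun s : ℝ ↦ f ((extChartAt I' y₀).symm
      ((extChartAt I' y₀) y₀ + (0 : ℝ) • b' i + s • b' j)))
    (V := fun s : ℝ ↦ covariantDerivAlong g.leviCivita (fun t : ℝ ↦ f ((extChartAt I' y₀).symm
        ((extChartAt I' y₀) y₀ + t • b' i + s • b' j))) (fun t ↦ mfderiv I' I f ((extChartAt I'
        y₀).symm ((extChartAt I' y₀) y₀ + t • b' i + s • b' j)) ((trivializationAt E' (TangentSpace
        I') y₀).localFrame b' j ((extChartAt I' y₀).symm ((extChartAt I' y₀) y₀ + t • b' i + s • b'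
        j)))) 0) (W := fun s : ℝ ↦ mfderiv I' I f ((extChartAt I' y₀).symm ((extChartAt I' y₀) y₀ +
        (0 : ℝ) • b' i + s • b' j)) ((trivializationAt E' (TangentSpace I') y₀).localFrame b' i
        ((extChartAt I' y₀).symm ((extChartAt I' y₀) y₀ + (0 : ℝ) • b' i + s • b' j)))) (t₀ := 0)
        hVBlift hWBlift).deriv
  have hAN := ((g.inducedMetric f hpb hfi).hasDerivAt_val_apply_along hcompatN (γ := fun t : ℝ ↦
      (extChartAt I' y₀).symm ((extChartAt I' y₀) y₀ + t • b' i + (0 : ℝ) • b' j))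
    (V := fun t : ℝ ↦ covariantDerivAlong (g.inducedMetric f hpb hfi).leviCivita (fun s : ℝ ↦
        (extChartAt I' y₀).symm ((extChartAt I' y₀) y₀ + t • b' i + s • b' j)) (fun s ↦
        (trivializationAt E' (TangentSpace I') y₀).localFrame b' j ((extChartAt I' y₀).symm
        ((extChartAt I' y₀) y₀ + t • b' i + s • b' j))) 0) (W := fun t : ℝ ↦ (trivializationAt E'
        (TangentSpace I') y₀).localFrame b' i ((extChartAt I' y₀).symm ((extChartAt I' y₀) y₀ + t •
        b' i + (0 : ℝ) • b' j))) (t₀ := 0) hVNlift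
    ((hWNlift).comp 0 hci)).deriv
  have hBN := ((g.inducedMetric f hpb hfi).hasDerivAt_val_apply_along hcompatN (γ := fun s : ℝ ↦
      (extChartAt I' y₀).symm ((extChartAt I' y₀) y₀ + (0 : ℝ) • b' i + s • b' j))
    (V := fun s : ℝ ↦ covariantDerivAlong (g.inducedMetric f hpb hfi).leviCivita (fun t : ℝ ↦
        (extChartAt I' y₀).symm ((extChartAt I' y₀) y₀ + t • b' i + s • b' j)) (fun t ↦
        (trivializationAt E' (TangentSpace I') y₀).localFrame b' j ((extChartAt I' y₀).symm
        ((extChartAt I' y₀) y₀ + t • b' i + s • b' j))) 0) (W := fun s : ℝ ↦ (trivializationAt E'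
        (TangentSpace I') y₀).localFrame b' i ((extChartAt I' y₀).symm ((extChartAt I' y₀) y₀ + (0
        : ℝ) • b' i + s • b' j))) (t₀ := 0) hVBNlift
    ((hWBNlift).comp 0 hcj)).deriv

  -- (I1), (I2): the first-order pairings agree near `0`, hence so do their derivatives
  have hmem_i : ∀ᶠ t : ℝ in 𝓝 0, (extChartAt I' y₀) y₀ + t • b' i + (0 : ℝ) • b' j ∈ (extChartAt I'
      y₀).target :=
    hℓi.continuousAt.preimage_mem_nhds ((isOpen_extChartAt_target y₀).mem_nhds hz00)
  have hmem_j : ∀ᶠ s : ℝ in 𝓝 0, (extChartAt I' y₀) y₀ + (0 : ℝ) • b' i + s • b' j ∈ (extChartAt I'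
      y₀).target :=
    hℓj.continuousAt.preimage_mem_nhds ((isOpen_extChartAt_target y₀).mem_nhds hz00)
  have haff_s : ∀ t s : ℝ, (extChartAt I' y₀) y₀ + t • b' i + s • b' j = (extChartAt I' y₀) y₀ + t
      • b' i + (0 : ℝ) • b' j + s • b' j := fun t s ↦ by
    simp only [zero_smul, add_zero]
  have haff_t : ∀ s t : ℝ, (extChartAt I' y₀) y₀ + t • b' i + s • b' j = (extChartAt I' y₀) y₀ + (0
      : ℝ) • b' i + s • b' j + t • b' i := fun s t ↦ by
    simp only [zero_smul, add_zero]; abel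
  have h1 : deriv (fun t : ℝ ↦ g.val (f ((extChartAt I' y₀).symm ((extChartAt I' y₀) y₀ + t • b' i
      + (0 : ℝ) • b' j))) (covariantDerivAlong g.leviCivita (fun s : ℝ ↦ f ((extChartAt I' y₀).symm
      ((extChartAt I' y₀) y₀ + t • b' i + s • b' j))) (fun s ↦ mfderiv I' I f ((extChartAt I'
      y₀).symm ((extChartAt I' y₀) y₀ + t • b' i + s • b' j)) ((trivializationAt E' (TangentSpace
      I') y₀).localFrame b' j ((extChartAt I' y₀).symm ((extChartAt I' y₀) y₀ + t • b' i + s • b'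
      j)))) 0) (mfderiv I' I f ((extChartAt I' y₀).symm ((extChartAt I' y₀) y₀ + t • b' i + (0 : ℝ)
      • b' j)) ((trivializationAt E' (TangentSpace I') y₀).localFrame b' i ((extChartAt I' y₀).symm
      ((extChartAt I' y₀) y₀ + t • b' i + (0 : ℝ) • b' j))))) 0 = deriv (fun t : ℝ ↦
      (g.inducedMetric f hpb hfi).val ((extChartAt I' y₀).symm ((extChartAt I' y₀) y₀ + t • b' i +
      (0 : ℝ) • b' j)) (covariantDerivAlong (g.inducedMetric f hpb hfi).leviCivita (fun s : ℝ ↦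
      (extChartAt I' y₀).symm ((extChartAt I' y₀) y₀ + t • b' i + s • b' j)) (fun s ↦
      (trivializationAt E' (TangentSpace I') y₀).localFrame b' j ((extChartAt I' y₀).symm
      ((extChartAt I' y₀) y₀ + t • b' i + s • b' j))) 0) ((trivializationAt E' (TangentSpace I')
      y₀).localFrame b' i ((extChartAt I' y₀).symm ((extChartAt I' y₀) y₀ + t • b' i + (0 : ℝ) • b'
      j)))) 0 := by
    refine Filter.EventuallyEq.deriv_eq ?_
    filter_upwards [hmem_i] with t ht
    exact val_covariantDerivAlong_mfderiv_localFrame_symm_comp₀ g hpb hfi b'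
      (ℓ := fun s : ℝ ↦ (extChartAt I' y₀) y₀ + t • b' i + s • b' j) ht (haff_s t) j
          ((trivializationAt E' (TangentSpace I') y₀).localFrame b' i ((extChartAt I' y₀).symm
          ((extChartAt I' y₀) y₀ + t • b' i + (0 : ℝ) • b' j)))
  have h2 : deriv (fun s : ℝ ↦ g.val (f ((extChartAt I' y₀).symm ((extChartAt I' y₀) y₀ + (0 : ℝ) •
      b' i + s • b' j))) (covariantDerivAlong g.leviCivita (fun t : ℝ ↦ f ((extChartAt I' y₀).symm
      ((extChartAt I' y₀) y₀ + t • b' i + s • b' j))) (fun t ↦ mfderiv I' I f ((extChartAt I'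
      y₀).symm ((extChartAt I' y₀) y₀ + t • b' i + s • b' j)) ((trivializationAt E' (TangentSpace
      I') y₀).localFrame b' j ((extChartAt I' y₀).symm ((extChartAt I' y₀) y₀ + t • b' i + s • b'
      j)))) 0) (mfderiv I' I f ((extChartAt I' y₀).symm ((extChartAt I' y₀) y₀ + (0 : ℝ) • b' i + s
      • b' j)) ((trivializationAt E' (TangentSpace I') y₀).localFrame b' i ((extChartAt I' y₀).symm
      ((extChartAt I' y₀) y₀ + (0 : ℝ) • b' i + s • b' j))))) 0 = deriv (fun s : ℝ ↦
      (g.inducedMetric f hpb hfi).val ((extChartAt I' y₀).symm ((extChartAt I' y₀) y₀ + (0 : ℝ) •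
      b' i + s • b' j)) (covariantDerivAlong (g.inducedMetric f hpb hfi).leviCivita (fun t : ℝ ↦
      (extChartAt I' y₀).symm ((extChartAt I' y₀) y₀ + t • b' i + s • b' j)) (fun t ↦
      (trivializationAt E' (TangentSpace I') y₀).localFrame b' j ((extChartAt I' y₀).symm
      ((extChartAt I' y₀) y₀ + t • b' i + s • b' j))) 0) ((trivializationAt E' (TangentSpace I')
      y₀).localFrame b' i ((extChartAt I' y₀).symm ((extChartAt I' y₀) y₀ + (0 : ℝ) • b' i + s • b'
      j)))) 0 := by
    refine Filter.EventuallyEq.deriv_eq ?_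
    filter_upwards [hmem_j] with s hs
    exact val_covariantDerivAlong_mfderiv_localFrame_symm_comp₀ g hpb hfi b'
      (ℓ := fun t : ℝ ↦ (extChartAt I' y₀) y₀ + t • b' i + s • b' j) hs (haff_t s) j
          ((trivializationAt E' (TangentSpace I') y₀).localFrame b' i ((extChartAt I' y₀).symm
          ((extChartAt I' y₀) y₀ + (0 : ℝ) • b' i + s • b' j)))
  -- the second-order cross terms: tangential and normal components at the base point
  have hν0 : ∀ u : TangentSpace I' ((extChartAt I' y₀).symm ((extChartAt I' y₀) y₀ + (0 : ℝ) • b' i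
      + (0 : ℝ) • b' j)), g.val (f ((extChartAt I' y₀).symm ((extChartAt I' y₀) y₀ + (0 : ℝ) • b' i
      + (0 : ℝ) • b' j))) (ν ((extChartAt I' y₀).symm ((extChartAt I' y₀) y₀ + (0 : ℝ) • b' i + (0
      : ℝ) • b' j))) (mfderiv I' I f ((extChartAt I' y₀).symm ((extChartAt I' y₀) y₀ + (0 : ℝ) • b'
      i + (0 : ℝ) • b' j)) (u)) = 0 :=
    fun u ↦ hun.1 _ u
  have hνε : g.val (f ((extChartAt I' y₀).symm ((extChartAt I' y₀) y₀ + (0 : ℝ) • b' i + (0 : ℝ) •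
      b' j))) (ν ((extChartAt I' y₀).symm ((extChartAt I' y₀) y₀ + (0 : ℝ) • b' i + (0 : ℝ) • b'
      j))) (ν ((extChartAt I' y₀).symm ((extChartAt I' y₀) y₀ + (0 : ℝ) • b' i + (0 : ℝ) • b' j)))
      = ε := hun.2 _
  have t1 := fun u ↦ val_covariantDerivAlong_mfderiv_localFrame_symm_comp₀ g hpb hfi b'
    (ℓ := fun s : ℝ ↦ (extChartAt I' y₀) y₀ + (0 : ℝ) • b' i + s • b' j) hz00 (haff_s 0) j u
  have t2 := fun u ↦ val_covariantDerivAlong_mfderiv_localFrame_symm_comp₀ g hpb hfi b'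
    (ℓ := fun t : ℝ ↦ (extChartAt I' y₀) y₀ + t • b' i + (0 : ℝ) • b' j) hz00 (haff_t 0) i u
  have t3 := fun u ↦ val_covariantDerivAlong_mfderiv_localFrame_symm_comp₀ g hpb hfi b'
    (ℓ := fun t : ℝ ↦ (extChartAt I' y₀) y₀ + t • b' i + (0 : ℝ) • b' j) hz00 (haff_t 0) j u
  have t4 := fun u ↦ val_covariantDerivAlong_mfderiv_localFrame_symm_comp₀ g hpb hfi b'
    (ℓ := fun s : ℝ ↦ (extChartAt I' y₀) y₀ + (0 : ℝ) • b' i + s • b' j) hz00 (haff_s 0) i u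
  have n1 := val_covariantDerivAlong_mfderiv_localFrame_normal₀ g b' hf2 hν hun.1
    (ℓ := fun s : ℝ ↦ (extChartAt I' y₀) y₀ + (0 : ℝ) • b' i + s • b' j) hz00 (haff_s 0) j
  have n2 := val_covariantDerivAlong_mfderiv_localFrame_normal₀ g b' hf2 hν hun.1
    (ℓ := fun t : ℝ ↦ (extChartAt I' y₀) y₀ + t • b' i + (0 : ℝ) • b' j) hz00 (haff_t 0) i
  have n3 := val_covariantDerivAlong_mfderiv_localFrame_normal₀ g b' hf2 hν hun.1
    (ℓ := fun t : ℝ ↦ (extChartAt I' y₀) y₀ + t • b' i + (0 : ℝ) • b' j) hz00 (haff_t 0) j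
  have n4 := val_covariantDerivAlong_mfderiv_localFrame_normal₀ g b' hf2 hν hun.1
    (ℓ := fun s : ℝ ↦ (extChartAt I' y₀) y₀ + (0 : ℝ) • b' i + s • b' j) hz00 (haff_s 0) i
  have hP1 := val_eq_inducedMetric_add_normal g hpb hfi hν0 hνε hε hdim t1 t2
  have hP2 := val_eq_inducedMetric_add_normal g hpb hfi hν0 hνε hε hdim t3 t4
  rw [n1, n2] at hP1
  rw [n3, n4] at hP2
  -- assemble
  have key : (g.inducedMetric f hpb hfi).val ((extChartAt I' y₀).symm ((extChartAt I' y₀) y₀ + (0 :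
      ℝ) • b' i + (0 : ℝ) • b' j)) ((g.inducedMetric f hpb hfi).leviCivita.curvature ((extChartAt
      I' y₀).symm ((extChartAt I' y₀) y₀ + (0 : ℝ) • b' i + (0 : ℝ) • b' j)) ((trivializationAt E'
      (TangentSpace I') y₀).localFrame b' i ((extChartAt I' y₀).symm ((extChartAt I' y₀) y₀ + (0 :
      ℝ) • b' i + (0 : ℝ) • b' j))) ((trivializationAt E' (TangentSpace I') y₀).localFrame b' j
      ((extChartAt I' y₀).symm ((extChartAt I' y₀) y₀ + (0 : ℝ) • b' i + (0 : ℝ) • b' j)))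
      ((trivializationAt E' (TangentSpace I') y₀).localFrame b' j ((extChartAt I' y₀).symm
      ((extChartAt I' y₀) y₀ + (0 : ℝ) • b' i + (0 : ℝ) • b' j)))) ((trivializationAt E'
      (TangentSpace I') y₀).localFrame b' i ((extChartAt I' y₀).symm ((extChartAt I' y₀) y₀ + (0 :
      ℝ) • b' i + (0 : ℝ) • b' j))) =
      g.val (f ((extChartAt I' y₀).symm ((extChartAt I' y₀) y₀ + (0 : ℝ) • b' i + (0 : ℝ) • b' j)))
          (g.leviCivita.curvature (f ((extChartAt I' y₀).symm ((extChartAt I' y₀) y₀ + (0 : ℝ) • b'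
          i + (0 : ℝ) • b' j))) (mfderiv I' I f ((extChartAt I' y₀).symm ((extChartAt I' y₀) y₀ +
          (0 : ℝ) • b' i + (0 : ℝ) • b' j)) ((trivializationAt E' (TangentSpace I') y₀).localFrame
          b' i ((extChartAt I' y₀).symm ((extChartAt I' y₀) y₀ + (0 : ℝ) • b' i + (0 : ℝ) • b'
          j)))) (mfderiv I' I f ((extChartAt I' y₀).symm ((extChartAt I' y₀) y₀ + (0 : ℝ) • b' i +
          (0 : ℝ) • b' j)) ((trivializationAt E' (TangentSpace I') y₀).localFrame b' j ((extChartAt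
          I' y₀).symm ((extChartAt I' y₀) y₀ + (0 : ℝ) • b' i + (0 : ℝ) • b' j)))) (mfderiv I' I f
          ((extChartAt I' y₀).symm ((extChartAt I' y₀) y₀ + (0 : ℝ) • b' i + (0 : ℝ) • b' j))
          ((trivializationAt E' (TangentSpace I') y₀).localFrame b' j ((extChartAt I' y₀).symm
          ((extChartAt I' y₀) y₀ + (0 : ℝ) • b' i + (0 : ℝ) • b' j))))) (mfderiv I' I f
          ((extChartAt I' y₀).symm ((extChartAt I' y₀) y₀ + (0 : ℝ) • b' i + (0 : ℝ) • b' j))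
          ((trivializationAt E' (TangentSpace I') y₀).localFrame b' i ((extChartAt I' y₀).symm
          ((extChartAt I' y₀) y₀ + (0 : ℝ) • b' i + (0 : ℝ) • b' j)))) +
      ((g.secondFundamentalForm I' f ν ((extChartAt I' y₀).symm ((extChartAt I' y₀) y₀ + (0 : ℝ) •
          b' i + (0 : ℝ) • b' j)) ((trivializationAt E' (TangentSpace I') y₀).localFrame b' i
          ((extChartAt I' y₀).symm ((extChartAt I' y₀) y₀ + (0 : ℝ) • b' i + (0 : ℝ) • b' j)))
          ((trivializationAt E' (TangentSpace I') y₀).localFrame b' i ((extChartAt I' y₀).symm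
          ((extChartAt I' y₀) y₀ + (0 : ℝ) • b' i + (0 : ℝ) • b' j)))) * (g.secondFundamentalForm
          I' f ν ((extChartAt I' y₀).symm ((extChartAt I' y₀) y₀ + (0 : ℝ) • b' i + (0 : ℝ) • b'
          j)) ((trivializationAt E' (TangentSpace I') y₀).localFrame b' j ((extChartAt I' y₀).symm
          ((extChartAt I' y₀) y₀ + (0 : ℝ) • b' i + (0 : ℝ) • b' j))) ((trivializationAt E'
          (TangentSpace I') y₀).localFrame b' j ((extChartAt I' y₀).symm ((extChartAt I' y₀) y₀ +
          (0 : ℝ) • b' i + (0 : ℝ) • b' j)))) / ε - (g.secondFundamentalForm I' f ν ((extChartAt I'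
          y₀).symm ((extChartAt I' y₀) y₀ + (0 : ℝ) • b' i + (0 : ℝ) • b' j)) ((trivializationAt E'
          (TangentSpace I') y₀).localFrame b' i ((extChartAt I' y₀).symm ((extChartAt I' y₀) y₀ +
          (0 : ℝ) • b' i + (0 : ℝ) • b' j))) ((trivializationAt E' (TangentSpace I') y₀).localFrame
          b' j ((extChartAt I' y₀).symm ((extChartAt I' y₀) y₀ + (0 : ℝ) • b' i + (0 : ℝ) • b'
          j)))) * (g.secondFundamentalForm I' f ν ((extChartAt I' y₀).symm ((extChartAt I' y₀) y₀ +
          (0 : ℝ) • b' i + (0 : ℝ) • b' j)) ((trivializationAt E' (TangentSpace I') y₀).localFrame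
          b' j ((extChartAt I' y₀).symm ((extChartAt I' y₀) y₀ + (0 : ℝ) • b' i + (0 : ℝ) • b' j)))
          ((trivializationAt E' (TangentSpace I') y₀).localFrame b' i ((extChartAt I' y₀).symm
          ((extChartAt I' y₀) y₀ + (0 : ℝ) • b' i + (0 : ℝ) • b' j)))) / ε) := by
    have e1 : -(g.secondFundamentalForm I' f ν ((extChartAt I' y₀).symm ((extChartAt I' y₀) y₀ + (0
        : ℝ) • b' i + (0 : ℝ) • b' j)) ((trivializationAt E' (TangentSpace I') y₀).localFrame b' j
        ((extChartAt I' y₀).symm ((extChartAt I' y₀) y₀ + (0 : ℝ) • b' i + (0 : ℝ) • b' j)))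
        ((trivializationAt E' (TangentSpace I') y₀).localFrame b' j ((extChartAt I' y₀).symm
        ((extChartAt I' y₀) y₀ + (0 : ℝ) • b' i + (0 : ℝ) • b' j)))) * -(g.secondFundamentalForm I'
        f ν ((extChartAt I' y₀).symm ((extChartAt I' y₀) y₀ + (0 : ℝ) • b' i + (0 : ℝ) • b' j))
        ((trivializationAt E' (TangentSpace I') y₀).localFrame b' i ((extChartAt I' y₀).symm
        ((extChartAt I' y₀) y₀ + (0 : ℝ) • b' i + (0 : ℝ) • b' j))) ((trivializationAt E'
        (TangentSpace I') y₀).localFrame b' i ((extChartAt I' y₀).symm ((extChartAt I' y₀) y₀ + (0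
        : ℝ) • b' i + (0 : ℝ) • b' j)))) / ε = (g.secondFundamentalForm I' f ν ((extChartAt I'
        y₀).symm ((extChartAt I' y₀) y₀ + (0 : ℝ) • b' i + (0 : ℝ) • b' j)) ((trivializationAt E'
        (TangentSpace I') y₀).localFrame b' i ((extChartAt I' y₀).symm ((extChartAt I' y₀) y₀ + (0
        : ℝ) • b' i + (0 : ℝ) • b' j))) ((trivializationAt E' (TangentSpace I') y₀).localFrame b' i
        ((extChartAt I' y₀).symm ((extChartAt I' y₀) y₀ + (0 : ℝ) • b' i + (0 : ℝ) • b' j)))) *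
        (g.secondFundamentalForm I' f ν ((extChartAt I' y₀).symm ((extChartAt I' y₀) y₀ + (0 : ℝ) •
        b' i + (0 : ℝ) • b' j)) ((trivializationAt E' (TangentSpace I') y₀).localFrame b' j
        ((extChartAt I' y₀).symm ((extChartAt I' y₀) y₀ + (0 : ℝ) • b' i + (0 : ℝ) • b' j)))
        ((trivializationAt E' (TangentSpace I') y₀).localFrame b' j ((extChartAt I' y₀).symm
        ((extChartAt I' y₀) y₀ + (0 : ℝ) • b' i + (0 : ℝ) • b' j)))) / ε := by ring
    have e2 : -(g.secondFundamentalForm I' f ν ((extChartAt I' y₀).symm ((extChartAt I' y₀) y₀ + (0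
        : ℝ) • b' i + (0 : ℝ) • b' j)) ((trivializationAt E' (TangentSpace I') y₀).localFrame b' i
        ((extChartAt I' y₀).symm ((extChartAt I' y₀) y₀ + (0 : ℝ) • b' i + (0 : ℝ) • b' j)))
        ((trivializationAt E' (TangentSpace I') y₀).localFrame b' j ((extChartAt I' y₀).symm
        ((extChartAt I' y₀) y₀ + (0 : ℝ) • b' i + (0 : ℝ) • b' j)))) * -(g.secondFundamentalForm I'
        f ν ((extChartAt I' y₀).symm ((extChartAt I' y₀) y₀ + (0 : ℝ) • b' i + (0 : ℝ) • b' j))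
        ((trivializationAt E' (TangentSpace I') y₀).localFrame b' j ((extChartAt I' y₀).symm
        ((extChartAt I' y₀) y₀ + (0 : ℝ) • b' i + (0 : ℝ) • b' j))) ((trivializationAt E'
        (TangentSpace I') y₀).localFrame b' i ((extChartAt I' y₀).symm ((extChartAt I' y₀) y₀ + (0
        : ℝ) • b' i + (0 : ℝ) • b' j)))) / ε = (g.secondFundamentalForm I' f ν ((extChartAt I'
        y₀).symm ((extChartAt I' y₀) y₀ + (0 : ℝ) • b' i + (0 : ℝ) • b' j)) ((trivializationAt E'
        (TangentSpace I') y₀).localFrame b' i ((extChartAt I' y₀).symm ((extChartAt I' y₀) y₀ + (0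
        : ℝ) • b' i + (0 : ℝ) • b' j))) ((trivializationAt E' (TangentSpace I') y₀).localFrame b' j
        ((extChartAt I' y₀).symm ((extChartAt I' y₀) y₀ + (0 : ℝ) • b' i + (0 : ℝ) • b' j)))) *
        (g.secondFundamentalForm I' f ν ((extChartAt I' y₀).symm ((extChartAt I' y₀) y₀ + (0 : ℝ) •
        b' i + (0 : ℝ) • b' j)) ((trivializationAt E' (TangentSpace I') y₀).localFrame b' j
        ((extChartAt I' y₀).symm ((extChartAt I' y₀) y₀ + (0 : ℝ) • b' i + (0 : ℝ) • b' j)))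
        ((trivializationAt E' (TangentSpace I') y₀).localFrame b' i ((extChartAt I' y₀).symm
        ((extChartAt I' y₀) y₀ + (0 : ℝ) • b' i + (0 : ℝ) • b' j)))) / ε := by ring
    linarith [hM, hA, hB, h1, h2, hN, hAN, hBN, hP1, hP2, e1, e2]
  rw [← sub_div, hq] at key
  exact key

end Gauss

end Literature.Geometry.Lorentzian

end
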